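import Mathlib
import HarnessLib

/-!
# A uniform lower frame bound for the monomials `x^{j−ℓ}` (`j < n ≤ ℓ`) in `L²(R, ∞)`

Analysis/Calculus support file (everything proved, no definitions). For `n ≤ ℓ` there is
`σ = σ(ℓ, n) > 0` such that for every `R ≥ 1` and all coefficients `μ₀, …, μ_{n−1}`

  `σ Σ_{j<n} μ_j² R^{2(j−ℓ)+1} ≤ ∫_R^∞ (Σ_{j<n} μ_j x^{j−ℓ})² dx`      (`monomial_frame_bound`).

Proof: the integral is the explicit Gram form `Σ_{j,j'} μ_jμ_{j'} R^{j+j'−2ℓ+1}/(2ℓ−j−j'−1)`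
(`integral_Ioi_monomialSum_sq`), which after the substitution `ν_j = μ_j R^{j−ℓ+1/2}` no longer
depends on `R`; the `R = 1` form is positive definite (a nonzero real polynomial has finitely many
roots) and continuous, hence bounded below on the unit sphere of `ℝⁿ` by compactness. This is the
finite-dimensional "kernel transfer" constant of the far-side channel estimate: it converts the
energy of an exact inverse-square kernel element `Σ λ_j c_j x^{j−ℓ}` on `(R, ∞)` into the size of its
coefficients, uniformly in the cone radius `R` (route PhotonSphereChannels, `FixedModeChannels`,
stmt-FinalStateConjecture-10048; the position-energy version follows by applying the lemma with
`ℓ + 1`, since `∫ (f')² + ℓ(ℓ+1)f²/x² ≥ ℓ(ℓ+1)∫ (f/x)²`). Folklore linear algebra / calculus.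
-/

noncomputable section

namespace Literature.Analysis.Calculus

open MeasureTheory Set Filter Topology Finset

/-- **Explicit Gram form.** For `n ≤ ℓ`, `R ≥ 1`: the square of `Σ_{j<n} μ_j x^{j−ℓ}` is integrable
on `(R, ∞)` and `∫_R^∞ (Σ μ_j x^{j−ℓ})² = Σ_{j,j'} μ_jμ_{j'} R^{j+j'−2ℓ+1}/(2ℓ−j−j'−1)`. [folklore] -/
theorem integral_Ioi_monomialSum_sq (ℓ n : ℕ) (hn : n ≤ ℓ) (μ : ℕ → ℝ) {R : ℝ} (hR : 1 ≤ R) :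
    IntegrableOn (fun x : ℝ => (∑ j ∈ range n, μ j * x ^ ((j : ℝ) - ℓ)) ^ 2) (Ioi R) ∧
      ∫ x in Ioi R, (∑ j ∈ range n, μ j * x ^ ((j : ℝ) - ℓ)) ^ 2
        = ∑ j ∈ range n, ∑ j' ∈ range n,
            μ j * μ j' * R ^ ((j : ℝ) + j' - 2 * ℓ + 1) / (2 * ℓ - j - j' - 1) := by
  have hR0 : 0 < R := by linarith
  -- expand the square on `x > 0`
  set g : ℝ → ℝ := fun x => ∑ j ∈ range n, ∑ j' ∈ range n,
    μ j * μ j' * x ^ ((j : ℝ) + j' - 2 * ℓ) with hg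
  have hexp : ∀ x : ℝ, 0 < x →
      (∑ j ∈ range n, μ j * x ^ ((j : ℝ) - ℓ)) ^ 2 = g x := by
    intro x hx
    rw [sq, sum_mul_sum]
    refine sum_congr rfl fun j _ => sum_congr rfl fun j' _ => ?_
    rw [show (j : ℝ) + j' - 2 * ℓ = ((j : ℝ) - ℓ) + ((j' : ℝ) - ℓ) by ring, Real.rpow_add hx]
    ring
  have heq : EqOn (fun x : ℝ => (∑ j ∈ range n, μ j * x ^ ((j : ℝ) - ℓ)) ^ 2) g (Ioi R) :=
    fun x hx => hexp x (hR0.trans hx)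
  -- exponents are `< -1`
  have hexp_lt : ∀ j ∈ range n, ∀ j' ∈ range n, (j : ℝ) + j' - 2 * ℓ < -1 := by
    intro j hj j' hj'
    have h1 : (j : ℝ) + 1 ≤ n := by exact_mod_cast mem_range.1 hj
    have h2 : (j' : ℝ) + 1 ≤ n := by exact_mod_cast mem_range.1 hj'
    have h3 : (n : ℝ) ≤ ℓ := by exact_mod_cast hn
    linarith
  have hterm : ∀ j ∈ range n, ∀ j' ∈ range n,
      IntegrableOn (fun x : ℝ => μ j * μ j' * x ^ ((j : ℝ) + j' - 2 * ℓ)) (Ioi R) :=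
    fun j hj j' hj' => (integrableOn_Ioi_rpow_of_lt (hexp_lt j hj j' hj') hR0).const_mul _
  have hgi : IntegrableOn g (Ioi R) :=
    integrable_finsetSum _ fun j hj => integrable_finsetSum _ fun j' hj' => hterm j hj j' hj'
  refine ⟨hgi.congr_fun heq.symm measurableSet_Ioi, ?_⟩
  rw [setIntegral_congr_fun measurableSet_Ioi heq]
  simp only [hg]
  rw [integral_finsetSum _ fun j hj => integrable_finsetSum _ fun j' hj' => hterm j hj j' hj']
  refine sum_congr rfl fun j hj => ?_
  rw [integral_finsetSum _ fun j' hj' => hterm j hj j' hj']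
  refine sum_congr rfl fun j' hj' => ?_
  rw [MeasureTheory.integral_const_mul, integral_Ioi_rpow_of_lt (hexp_lt j hj j' hj') hR0]
  have hne : (j : ℝ) + j' - 2 * ℓ + 1 ≠ 0 := by linarith [hexp_lt j hj j' hj']
  have hne' : (2 : ℝ) * ℓ - j - j' - 1 ≠ 0 := by linarith [hexp_lt j hj j' hj']
  field_simp
  ring

/-- A finite sum of monomials `Σ_{j<n} v_j x^{j−ℓ}` that vanishes on `(1, ∞)` has zero coefficients.
[folklore] -/
theorem eq_zero_of_monomialSum_eq_zero (ℓ n : ℕ) (v : ℕ → ℝ)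
    (h : ∀ x : ℝ, 1 < x → ∑ j ∈ range n, v j * x ^ ((j : ℝ) - ℓ) = 0) :
    ∀ j, j < n → v j = 0 := by
  classical
  set p : Polynomial ℝ := ∑ j ∈ range n, Polynomial.C (v j) * Polynomial.X ^ j with hp
  have heval : ∀ x : ℝ, 1 < x → p.eval x = 0 := by
    intro x hx
    have hx0 : 0 < x := by linarith
    have := h x hx
    have hmul : x ^ (ℓ : ℝ) * ∑ j ∈ range n, v j * x ^ ((j : ℝ) - ℓ) = ∑ j ∈ range n, v j * x ^ j := by
      rw [mul_sum]
      refine sum_congr rfl fun j _ => ?_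
      rw [mul_left_comm, ← Real.rpow_add hx0, show (ℓ : ℝ) + ((j : ℝ) - ℓ) = (j : ℕ) by ring,
        Real.rpow_natCast]
    rw [this, mul_zero] at hmul
    simp only [hp, Polynomial.eval_finsetSum, Polynomial.eval_mul, Polynomial.eval_C,
      Polynomial.eval_pow, Polynomial.eval_X]
    exact hmul.symm
  have hp0 : p = 0 := by
    refine Polynomial.eq_zero_of_infinite_isRoot p (Set.Infinite.mono (fun x hx => ?_) (Ioi_infinite (1 : ℝ)))
    exact heval x hx
  intro j hj
  have hc : p.coeff j = v j := by
    simp only [hp, Polynomial.finsetSum_coeff, Polynomial.coeff_C_mul_X_pow]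
    rw [Finset.sum_ite_eq]
    simp [mem_range.2 hj]
  rw [← hc, hp0, Polynomial.coeff_zero]

/-- **Uniform lower frame bound for `x^{j−ℓ}`, `j < n ≤ ℓ`, in `L²(R,∞)`.** See the module docstring.
[folklore] -/
theorem monomial_frame_bound (ℓ n : ℕ) (hn : n ≤ ℓ) :
    ∃ σ : ℝ, 0 < σ ∧ ∀ (μ : ℕ → ℝ) (R : ℝ), 1 ≤ R →
      σ * ∑ j ∈ range n, μ j ^ 2 * R ^ (2 * ((j : ℝ) - ℓ) + 1)
        ≤ ∫ x in Ioi R, (∑ j ∈ range n, μ j * x ^ ((j : ℝ) - ℓ)) ^ 2 := by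
  classical
  rcases Nat.eq_zero_or_pos n with hn0 | hnpos
  · subst hn0
    refine ⟨1, one_pos, fun μ R hR => ?_⟩
    simp
  -- the Gram form on `ℝⁿ`
  set E := EuclideanSpace ℝ (Fin n)
  set Q : E → ℝ := fun v => ∑ i : Fin n, ∑ i' : Fin n,
    v i * v i' / (2 * ℓ - (i : ℕ) - (i' : ℕ) - 1) with hQ
  have hQc : Continuous Q := by
    refine continuous_finsetSum _ fun i _ => continuous_finsetSum _ fun i' _ => ?_
    exact (((EuclideanSpace.proj i).continuous).mul ((EuclideanSpace.proj i').continuous)).div_const _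
  -- `Q` versus the integral at `R = 1`, and homogeneity
  have hQint : ∀ v : E, Q v = ∫ x in Ioi (1 : ℝ),
      (∑ j ∈ range n, (fun j => if h : j < n then v ⟨j, h⟩ else 0) j * x ^ ((j : ℝ) - ℓ)) ^ 2 := by
    intro v
    rw [(integral_Ioi_monomialSum_sq ℓ n hn _ le_rfl).2]
    simp only [hQ, Real.one_rpow, mul_one]
    rw [Finset.sum_range]
    refine sum_congr rfl fun i _ => ?_
    rw [Finset.sum_range]
    refine sum_congr rfl fun i' _ => ?_
    simp [i.isLt, i'.isLt]
  have hQsmul : ∀ (c : ℝ) (v : E), Q (c • v) = c ^ 2 * Q v := by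
    intro c v
    simp only [hQ, mul_sum]
    refine sum_congr rfl fun i _ => sum_congr rfl fun i' _ => ?_
    rw [WithLp.ofLp_smul, Pi.smul_apply, Pi.smul_apply, smul_eq_mul, smul_eq_mul]
    ring
  -- positivity on nonzero vectors
  have hQpos : ∀ v : E, v ≠ 0 → 0 < Q v := by
    intro v hv
    set w : ℕ → ℝ := fun j => if h : j < n then v ⟨j, h⟩ else 0 with hw
    set gfun : ℝ → ℝ := fun x => ∑ j ∈ range n, w j * x ^ ((j : ℝ) - ℓ) with hgfun
    -- some point `x₀ > 1` with `gfun x₀ ≠ 0`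
    have hex : ∃ x₀ : ℝ, 1 < x₀ ∧ gfun x₀ ≠ 0 := by
      by_contra hcon
      have hall : ∀ x : ℝ, 1 < x → gfun x = 0 := fun x hx => by
        by_contra hne; exact hcon ⟨x, hx, hne⟩
      have hz := eq_zero_of_monomialSum_eq_zero ℓ n w hall
      apply hv
      ext i
      have := hz i i.isLt
      simp only [hw, i.isLt, dif_pos] at this
      simpa using this
    obtain ⟨x₀, hx₀, hg0⟩ := hex
    -- continuity of `gfun` on `(0, ∞)`
    have hgc : ContinuousOn gfun (Ioi 0) := by
      refine continuousOn_finsetSum _ fun j _ => continuousOn_const.mul ?_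
      exact continuousOn_id.rpow_const fun x hx => Or.inl (ne_of_gt hx)
    have hgca : ContinuousAt gfun x₀ := hgc.continuousAt (Ioi_mem_nhds (by linarith))
    -- a neighbourhood where `|gfun| > |gfun x₀|/2`
    have hε : 0 < |gfun x₀| / 2 := by positivity
    obtain ⟨δ, hδ0, hδ⟩ := Metric.continuousAt_iff.1 hgca _ hε
    set δ' : ℝ := min (δ / 2) ((x₀ - 1) / 2) with hδ'
    have hδ'0 : 0 < δ' := lt_min (by linarith) (by linarith)
    have hδ'1 : 1 < x₀ - δ' := by
      have : δ' ≤ (x₀ - 1) / 2 := min_le_right _ _; linarith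
    have hlow : ∀ x ∈ Icc (x₀ - δ') (x₀ + δ'), (|gfun x₀| / 2) ^ 2 ≤ gfun x ^ 2 := by
      intro x hx
      have hdist : dist x x₀ < δ := by
        rw [Real.dist_eq]
        have h1 : δ' ≤ δ / 2 := min_le_left _ _
        have : |x - x₀| ≤ δ' := abs_le.2 ⟨by linarith [hx.1], by linarith [hx.2]⟩
        linarith
      have h := hδ hdist
      rw [Real.dist_eq] at h
      have h2 : |gfun x₀| / 2 ≤ |gfun x| := by
        have := abs_sub_abs_le_abs_sub (gfun x₀) (gfun x)
        rw [abs_sub_comm] at this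
        linarith
      calc (|gfun x₀| / 2) ^ 2 ≤ |gfun x| ^ 2 := pow_le_pow_left₀ hε.le h2 2
        _ = gfun x ^ 2 := sq_abs _
    -- compare integrals
    obtain ⟨hint1, -⟩ := integral_Ioi_monomialSum_sq ℓ n hn w le_rfl
    have hsub : Ioc (x₀ - δ') (x₀ + δ') ⊆ Ioi (1 : ℝ) := fun x hx => lt_trans hδ'1 hx.1
    rw [hQint v]
    calc (0 : ℝ) < ∫ x in (x₀ - δ')..(x₀ + δ'), (|gfun x₀| / 2) ^ 2 := by
          rw [intervalIntegral.integral_const]; simp; positivity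
      _ ≤ ∫ x in (x₀ - δ')..(x₀ + δ'), gfun x ^ 2 := by
          refine intervalIntegral.integral_mono_on (by linarith) (by simp) ?_ hlow
          exact (intervalIntegrable_iff_integrableOn_Ioc_of_le (by linarith)).2 (hint1.mono_set hsub)
      _ = ∫ x in Ioc (x₀ - δ') (x₀ + δ'), gfun x ^ 2 := intervalIntegral.integral_of_le (by linarith)
      _ ≤ ∫ x in Ioi (1 : ℝ), gfun x ^ 2 :=
          setIntegral_mono_set hint1 (ae_of_all _ fun x => sq_nonneg _) (ae_of_all _ hsub)
  -- minimum of `Q` on the unit sphere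
  have hS : IsCompact (Metric.sphere (0 : E) 1) := isCompact_sphere _ _
  set e0 : E := PiLp.single 2 (⟨0, hnpos⟩ : Fin n) (1 : ℝ) with he0
  have he0S : e0 ∈ Metric.sphere (0 : E) 1 := by
    rw [mem_sphere_zero_iff_norm, he0, PiLp.norm_single, norm_one]
  obtain ⟨v₀, hv₀S, hmin⟩ := hS.exists_isMinOn ⟨e0, he0S⟩ hQc.continuousOn
  have hv₀ : v₀ ≠ 0 := by
    intro h; rw [h, mem_sphere_zero_iff_norm, norm_zero] at hv₀S; exact zero_ne_one hv₀S
  set σ : ℝ := Q v₀ with hσ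
  have hσ0 : 0 < σ := hQpos v₀ hv₀
  have hQge : ∀ v : E, σ * ‖v‖ ^ 2 ≤ Q v := by
    intro v
    by_cases hv : v = 0
    · subst hv
      have : Q 0 = 0 := by simp [hQ]
      rw [this, norm_zero]; simp
    · have hnv : 0 < ‖v‖ := norm_pos_iff.2 hv
      set u : E := ‖v‖⁻¹ • v with hu
      have huS : u ∈ Metric.sphere (0 : E) 1 := by
        rw [mem_sphere_zero_iff_norm, hu, norm_smul, norm_inv, norm_norm, inv_mul_cancel₀ hnv.ne']
      have h1 : σ ≤ Q u := hmin huS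
      have h2 : Q v = ‖v‖ ^ 2 * Q u := by
        have hv' : v = ‖v‖ • u := by rw [hu, smul_smul, mul_inv_cancel₀ hnv.ne', one_smul]
        conv_lhs => rw [hv']
        exact hQsmul _ _
      rw [h2, mul_comm]
      exact mul_le_mul_of_nonneg_left h1 (sq_nonneg _)
  refine ⟨σ, hσ0, fun μ R hR => ?_⟩
  have hR0 : 0 < R := by linarith
  -- the rescaled vector `ν_j = μ_j R^{j−ℓ+1/2}`
  set ν : ℕ → ℝ := fun j => μ j * R ^ ((j : ℝ) - ℓ + 1 / 2) with hν
  set v : E := WithLp.toLp 2 (fun i : Fin n => ν i) with hvdef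
  have hvi : ∀ i : Fin n, v i = ν i := fun i => rfl
  -- (a) the left-hand side is `σ ‖v‖²`
  have hlhs : ∑ j ∈ range n, μ j ^ 2 * R ^ (2 * ((j : ℝ) - ℓ) + 1) = ‖v‖ ^ 2 := by
    rw [EuclideanSpace.real_norm_sq_eq, Finset.sum_range]
    refine sum_congr rfl fun i _ => ?_
    rw [hvi, hν]
    simp only
    rw [mul_pow, ← Real.rpow_natCast (R ^ ((i : ℝ) - ℓ + 1 / 2)) 2, ← Real.rpow_mul hR0.le]
    congr 2; push_cast; ring
  -- (b) the right-hand side is `Q v`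
  have hrhs : ∫ x in Ioi R, (∑ j ∈ range n, μ j * x ^ ((j : ℝ) - ℓ)) ^ 2 = Q v := by
    rw [(integral_Ioi_monomialSum_sq ℓ n hn μ hR).2]
    simp only [hQ]
    rw [Finset.sum_range]
    refine sum_congr rfl fun i _ => ?_
    rw [Finset.sum_range]
    refine sum_congr rfl fun i' _ => ?_
    rw [hvi, hvi, hν]
    simp only
    rw [show (i : ℝ) + (i' : ℕ) - 2 * ℓ + 1 = ((i : ℝ) - ℓ + 1 / 2) + (((i' : ℕ) : ℝ) - ℓ + 1 / 2) by ring,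
      Real.rpow_add hR0]
    ring
  rw [hlhs, hrhs]
  exact hQge v

/-- **Hardy-weighted (position-energy) version.** For `n ≤ ℓ + 1` there is `σ > 0` with
`σ Σ_{j<n} μ_j² R^{2(j−ℓ)−1} ≤ ∫_R^∞ x⁻² (Σ_{j<n} μ_j x^{j−ℓ})² dx` for all `R ≥ 1` (apply the frame
bound with `ℓ + 1`). Multiplied by `ℓ(ℓ+1)` the right-hand side is the potential part of the
inverse-square energy of the position datum `Σ μ_j x^{j−ℓ}`. [folklore] -/
theorem monomial_frame_bound_weighted (ℓ n : ℕ) (hn : n ≤ ℓ + 1) :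
    ∃ σ : ℝ, 0 < σ ∧ ∀ (μ : ℕ → ℝ) (R : ℝ), 1 ≤ R →
      σ * ∑ j ∈ range n, μ j ^ 2 * R ^ (2 * ((j : ℝ) - ℓ) - 1)
        ≤ ∫ x in Ioi R, x ^ (-(2 : ℝ)) * (∑ j ∈ range n, μ j * x ^ ((j : ℝ) - ℓ)) ^ 2 := by
  obtain ⟨σ, hσ, h⟩ := monomial_frame_bound (ℓ + 1) n hn
  refine ⟨σ, hσ, fun μ R hR => ?_⟩
  have hR0 : 0 < R := by linarith
  have h1 := h μ R hR
  have hl : ∑ j ∈ range n, μ j ^ 2 * R ^ (2 * ((j : ℝ) - ℓ) - 1)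
      = ∑ j ∈ range n, μ j ^ 2 * R ^ (2 * ((j : ℝ) - ((ℓ + 1 : ℕ) : ℝ)) + 1) :=
    sum_congr rfl fun j _ => by congr 1; congr 1; push_cast; ring
  have hr : EqOn (fun x : ℝ => x ^ (-(2 : ℝ)) * (∑ j ∈ range n, μ j * x ^ ((j : ℝ) - ℓ)) ^ 2)
      (fun x : ℝ => (∑ j ∈ range n, μ j * x ^ ((j : ℝ) - ((ℓ + 1 : ℕ) : ℝ))) ^ 2) (Ioi R) := by
    intro x hx
    have hx0 : 0 < x := hR0.trans hx
    simp only
    rw [show x ^ (-(2 : ℝ)) = (x ^ (-(1 : ℝ))) ^ 2 by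
      rw [← Real.rpow_natCast, ← Real.rpow_mul hx0.le]; norm_num, ← mul_pow, mul_sum]
    congr 1
    refine sum_congr rfl fun j _ => ?_
    rw [mul_left_comm, ← Real.rpow_add hx0]
    congr 1; congr 1; push_cast; ring
  rw [hl, setIntegral_congr_fun measurableSet_Ioi hr]
  exact h1

end Literature.Analysis.Calculus
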